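import Summits.QuantumFields.YangMills.Theorems.UnitScaleTiltProp8HalvingAssemblyInterior
import Summits.QuantumFields.YangMills.Theorems.UnitScaleTiltProp8HalvingRRow157
import Summits.QuantumFields.YangMills.Theorems.UnitScaleTiltProp8HalvingA1Row165TraceSU2
import HarnessLib

/-!
# Route `UnitScaleTilt`, crux K1 «MinimiserStabilityRegPr» (stmt-QuantumFields-19200), stub V2′ `stub_halvingStep` — the (H-E2E) census junctions, part 2 (★★OWNER ACK 28 (4)):
# **THE PER-SITE PRODUCER OF `H_of_packageInt`'s PACKAGE BODY FROM ROWS, THE (157)-R DISCHARGE, THE (165) SEAM AT THE STRUCTURE-LITERAL FAMILY, AND THE REGISTERED TEXT FROM ROWS**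

Cell `ym3-torus` (HUMAN RULING D-0037: YM₃ on the torus is ladder rung R3, not the Clay problem), width seat `ym-ust-19200-w8` g0∕s2.
`--supports stmt-QuantumFields-19200 --as helper`; definition-free, 0 sorry.  Census memo `H-E2E-CENSUS-w8s2(-v2).md` (19200 evidence #53∕#55) = the H DEPMAP of record
(RULING g26-№16); this file is its kernel-checked spine.

WHAT THIS FILE PROVES (no definition, no sorry):
* §1 ★ **`sitePackage_of_rows`** — the eleven-conjunct per-site body of ✓`HalvingAssemblyInterior.H_of_packageInt`'s hypothesis `pkg` (which had row SUPPLIERS but no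
  PRODUCER in the tree) from the P1 chart pair `(u, A)`, ANY `Hs`, ANY remainder map `C`, with `A′ := A + Hs (C A)`, `B := (j,c) ↦ Q_j(A′)(c)`, `A₁ := A′ − HM B` (HM = the plain
  kernel extension `Σ_c flatH e_c b • ·`, the (165)-su2 currency), `R := Hs (C A)`, and the ROWS (165)-A₁ ∧ (157)-R ∧ (160)-near ∧ (155)-far ∧ `e₁ ≤ K₁ε₀²` ∧ `e₃ ≤ K₂ε₀²`;
  decomposition `A = A₁ + HM B − R` by `abel`.
* §2 **`rRows_scaled_of_uniformDatum`** — the (157)-R rows for `R = Hs Y` DISCHARGED by ✓`HalvingRRow157.row157_of_kernelDatum` at the weighted-sup datum `X c = L^{k−j(c)}•Y c`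
  (spec (i) of ✓`exists_flatH_scaledExt`), for any index-uniform `‖Y c‖ ≤ t` (B3's hCq♭ shape): `e₃ = B₀B₃t`.
* §3 ★ **`sitePackage_of_rows_L5`** — the (165) SEAM: at `F = ⟨ℓ+1, hL, m, hm⟩`, `M = L·Mh`, ✓`HalvingA1Row165TraceSU2.row165_of_tracePairing_L5_su2` read at
  `A′ := A + Hs (C A)` and the current `W` feeds §1's `h165` by `exact` (no adapter): package body from the (165) row's own displayed inputs + the other rows.
* §4 **`stubText_of_siteRows`** — the REGISTERED TEXT of `BirthV10.stub_halvingStep` (verbatim) from the P2 text and per-site ROWS: ✓`stubText_of_packageInt_largeRho` ∘ §1.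
HONEST SCOPE.  Junction bookkeeping; every row is a hypothesis (suppliers and status in the census).  NOT a claim about the stub, the crux, the rung or the mass gap.

References: T. Bałaban, CMP **102** (1985) 277–309 [Balaban1985Variational] ((152)–(168) pp.301–304, Prop. 8 p.304).
-/

set_option autoImplicit false

noncomputable section

open scoped BigOperators Matrix.Norms.L2Operator

namespace Summit.QuantumFields.YangMills.Theorems.HalvingSitePackage

open Literature.MathematicalPhysics.QuantumFieldTheory.Balaban1983to89
open Literature.MathematicalPhysics.QuantumFieldTheory.Balaban1983to89.T3ContinuumYM3Torus
open Literature.MathematicalPhysics.QuantumFieldTheory.Balaban1983to89.T3PrintedRegularMinimiser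
open Literature.MathematicalPhysics.QuantumFieldTheory.Balaban1983to89.T3Thm1Carrier
open Complex (I)
open B5Eq117TorusCarriers (Mk)
open B5Eq118OneStroke (iterBlockOf)
open B5Prop12FieldsLattice (distSite distSite_nonneg)
open B6SectADomainsV1 (Domains)
open B6SectAOperatorsV1 (BondIdx)
open B7Prop1Explicit (expUnit)
open B7Eq92Concrete (mgauge)
open B8Ineq132 (BondTouches)
open B8Eq140Level (SideTouches Cond140)
open B8Eq143PlaqExpansion (pdiv)
open B8Eq146AExpansion (plaqCovDeriv)
open B8Eq184Proof (cfgExp)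
open B8Thm2SetupTorus (cfgPull gaugePull pullDom)
open B10Eq27TorusAxialLog (pull unitsField toUField transl)
open LatticeFieldCalculus (bondAvgIter)
open FlatCubeOpsText (Adm22 distBI IsLevWeight IsFlatH FlatOpsAdmAtMS HDecayLetterD RowSum162)
open FlatCubeSequenceAligned (cubeSeqMT3)
open FlatCubeSequenceAdm (adm22_cubeSeqMT3)
open FlatOpsLettersAssembly (flatH isFlatH_flatH)

/-! ## §1 The per-site junction: package body ⟸ rows -/

section Site

variable {F : T3Family} {n K : ℕ}

/-- **PER-SITE JUNCTION (pure algebra)**: the eleven-conjunct package body of `HalvingAssemblyInterior.H_of_packageInt` at the site `x` from the P1 chart clause for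
`(u, A)`, ANY linear `Hs`, ANY remainder map `C`, and the ROWS of `A′ := A + Hs (C A)`: (165)-A₁ for `A₁ := A′ − HM(Q A′)`, (157)-R for `R := Hs (C A)`, (160)∕(155)
for `B := Q A′`. [cite: Balaban1985Variational, (152)-(157) pp.301-302, (160) p.303, (165) p.304] -/
theorem sitePackage_of_rows (x : Site (F.P K) 0) (ρ S M : ℕ) (hM : 1 ≤ M) {ε₀ ε₁ C₁ C₂ K₁ K₂ e₁ e₃ : ℝ}
    (U : GaugeField (F.P K) 0 (Matrix.specialUnitaryGroup (Fin 2) ℂ))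
    (u : GaugeTransf (F.P K) 0 (Matrix.unitaryGroup (Fin 2) ℂ)) (A : PBond (F.P K) 0 → Matrix (Fin 2) (Fin 2) ℂ)
    (Hs : (BondIdx (cubeSeqMT3 F n K x ρ S M hM) → Matrix (Fin 2) (Fin 2) ℂ) → (PBond (F.P K) 0 → Matrix (Fin 2) (Fin 2) ℂ))
    (C : (PBond (F.P K) 0 → Matrix (Fin 2) (Fin 2) ℂ) → (BondIdx (cubeSeqMT3 F n K x ρ S M hM) → Matrix (Fin 2) (Fin 2) ℂ))
    (hA : ∀ b : PBond (F.P K) 0, IsSelfAdjoint (A b))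
    (hchart : ∀ (z : B7Prop1Explicit.Site (F.P K).d) (μ : Fin (F.P K).d),
      SideTouches (pullDom (fun j => if K - n ≤ j then ({x} : Set (Site (F.P K) 0)) else (∅ : Set (Site (F.P K) 0))) (K - n)) z μ →
      (Unitary.toUnits (u (transl 0 z)))⁻¹ * unitsField (toUField U) ⟨transl 0 z, μ⟩ * Unitary.toUnits (u ((transl 0 z).shift μ)) =
        expUnit (I • ((((F.L : ℝ)⁻¹) ^ (K - n)) • A ⟨transl 0 z, μ⟩)))
    -- the (165)-A₁ rows of `A₁ := A′ − HM(Q A′)`, `A′ := A + Hs (C A)` (shape of ✓`row165_of_tracePairing_L5_su2`'s conclusion)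
    (h165 :
      (∀ (z : B7Prop1Explicit.Site (F.P K).d) (τ : Fin (F.P K).d),
        SideTouches (pullDom (fun j => if K - n ≤ j then ({x} : Set (Site (F.P K) 0)) else (∅ : Set (Site (F.P K) 0))) (K - n)) z τ →
        ‖((A + Hs (C A)) - fun b : PBond (F.P K) 0 => ∑ c, flatH F n K (cubeSeqMT3 F n K x ρ S M hM) (Pi.single c 1) b •
            bondAvgIter (c.1.1 : ℕ) (A + Hs (C A)) c.1.2) ⟨transl 0 z, τ⟩‖ ≤ e₁) ∧
      (∀ (z : B7Prop1Explicit.Site (F.P K).d) (κ τ : Fin (F.P K).d),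
        SideTouches (pullDom (fun j => if K - n ≤ j then ({x} : Set (Site (F.P K) 0)) else (∅ : Set (Site (F.P K) 0))) (K - n)) z τ →
        ‖(((F.L : ℝ)⁻¹) ^ (K - n))⁻¹ •
          (((A + Hs (C A)) - fun b : PBond (F.P K) 0 => ∑ c, flatH F n K (cubeSeqMT3 F n K x ρ S M hM) (Pi.single c 1) b •
              bondAvgIter (c.1.1 : ℕ) (A + Hs (C A)) c.1.2) ⟨(transl 0 z).shift κ, τ⟩ -
            ((A + Hs (C A)) - fun b : PBond (F.P K) 0 => ∑ c, flatH F n K (cubeSeqMT3 F n K x ρ S M hM) (Pi.single c 1) b •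
              bondAvgIter (c.1.1 : ℕ) (A + Hs (C A)) c.1.2) ⟨transl 0 z, τ⟩)‖ ≤ e₁) ∧
      (∀ (z : B7Prop1Explicit.Site (F.P K).d) (μ : Fin (F.P K).d),
        BondTouches (pullDom (fun j => if K - n ≤ j then ({x} : Set (Site (F.P K) 0)) else (∅ : Set (Site (F.P K) 0))) (K - n)) z μ →
        ‖pdiv (((F.L : ℝ)⁻¹) ^ (K - n)) (1 : B7Prop1Explicit.Site (F.P K).d → Fin (F.P K).d → (Matrix (Fin 2) (Fin 2) ℂ)ˣ)
            (plaqCovDeriv (((F.L : ℝ)⁻¹) ^ (K - n)) (1 : B7Prop1Explicit.Site (F.P K).d → Fin (F.P K).d → (Matrix (Fin 2) (Fin 2) ℂ)ˣ)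
              (pull ((A + Hs (C A)) - fun b : PBond (F.P K) 0 => ∑ c, flatH F n K (cubeSeqMT3 F n K x ρ S M hM) (Pi.single c 1) b •
                bondAvgIter (c.1.1 : ℕ) (A + Hs (C A)) c.1.2) 0)) μ z‖ ≤ e₁))
    -- the (157)-R rows of `R := Hs (C A)` (shape of ✓`row157_of_kernelDatum`'s conclusion)
    (h157 :
      (∀ (z : B7Prop1Explicit.Site (F.P K).d) (τ : Fin (F.P K).d),
        SideTouches (pullDom (fun j => if K - n ≤ j then ({x} : Set (Site (F.P K) 0)) else (∅ : Set (Site (F.P K) 0))) (K - n)) z τ →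
        ‖Hs (C A) ⟨transl 0 z, τ⟩‖ ≤ e₃) ∧
      (∀ (z : B7Prop1Explicit.Site (F.P K).d) (κ τ : Fin (F.P K).d),
        SideTouches (pullDom (fun j => if K - n ≤ j then ({x} : Set (Site (F.P K) 0)) else (∅ : Set (Site (F.P K) 0))) (K - n)) z τ →
        ‖(((F.L : ℝ)⁻¹) ^ (K - n))⁻¹ • (Hs (C A) ⟨(transl 0 z).shift κ, τ⟩ - Hs (C A) ⟨transl 0 z, τ⟩)‖ ≤ e₃) ∧
      (∀ (z : B7Prop1Explicit.Site (F.P K).d) (μ : Fin (F.P K).d),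
        BondTouches (pullDom (fun j => if K - n ≤ j then ({x} : Set (Site (F.P K) 0)) else (∅ : Set (Site (F.P K) 0))) (K - n)) z μ →
        ‖pdiv (((F.L : ℝ)⁻¹) ^ (K - n)) (1 : B7Prop1Explicit.Site (F.P K).d → Fin (F.P K).d → (Matrix (Fin 2) (Fin 2) ℂ)ˣ)
            (plaqCovDeriv (((F.L : ℝ)⁻¹) ^ (K - n)) (1 : B7Prop1Explicit.Site (F.P K).d → Fin (F.P K).d → (Matrix (Fin 2) (Fin 2) ℂ)ˣ)
              (pull (Hs (C A)) 0)) μ z‖ ≤ e₃))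
    -- the (160)-near row of `B := Q A′` on the interior top bonds
    (hnear : ∀ c : BondIdx (cubeSeqMT3 F n K x ρ S M hM), (c.1.1 : ℕ) = K - n →
      c.1.2.src ∈ (cubeSeqMT3 F n K x ρ S M hM).Om (c.1.1 : ℕ) → c.1.2.tgt ∈ (cubeSeqMT3 F n K x ρ S M hM).Om (c.1.1 : ℕ) →
      ‖bondAvgIter (c.1.1 : ℕ) (A + Hs (C A)) c.1.2‖ ≤ C₁ * ε₁ * (distSite (Mk (F.P K) (c.1.1 : ℕ)) c.1.2.src (iterBlockOf (c.1.1 : ℕ) x) + 1))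
    -- the (155)-far row of `B := Q A′` on every other index bond
    (hfar : ∀ c : BondIdx (cubeSeqMT3 F n K x ρ S M hM),
      ¬ ((c.1.1 : ℕ) = K - n ∧ c.1.2.src ∈ (cubeSeqMT3 F n K x ρ S M hM).Om (c.1.1 : ℕ) ∧ c.1.2.tgt ∈ (cubeSeqMT3 F n K x ρ S M hM).Om (c.1.1 : ℕ)) →
      ‖bondAvgIter (c.1.1 : ℕ) (A + Hs (C A)) c.1.2‖ ≤ C₂ * ε₀ * (F.L : ℝ) ^ ((K - n) - (c.1.1 : ℕ)))
    (he₁ : e₁ ≤ K₁ * ε₀ ^ 2) (he₃ : e₃ ≤ K₂ * ε₀ ^ 2) :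
    ∃ (u : GaugeTransf (F.P K) 0 (Matrix.unitaryGroup (Fin 2) ℂ)) (A A₁ R : PBond (F.P K) 0 → Matrix (Fin 2) (Fin 2) ℂ)
      (B : BondIdx (cubeSeqMT3 F n K x ρ S M hM) → Matrix (Fin 2) (Fin 2) ℂ),
      (∀ b : PBond (F.P K) 0, IsSelfAdjoint (A b)) ∧
      (∀ (z : B7Prop1Explicit.Site (F.P K).d) (μ : Fin (F.P K).d),
        SideTouches (pullDom (fun j => if K - n ≤ j then ({x} : Set (Site (F.P K) 0)) else (∅ : Set (Site (F.P K) 0))) (K - n)) z μ →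
        (Unitary.toUnits (u (transl 0 z)))⁻¹ * unitsField (toUField U) ⟨transl 0 z, μ⟩ * Unitary.toUnits (u ((transl 0 z).shift μ)) =
          expUnit (I • ((((F.L : ℝ)⁻¹) ^ (K - n)) • A ⟨transl 0 z, μ⟩))) ∧
      (A = A₁ + (fun b => ∑ c, flatH F n K (cubeSeqMT3 F n K x ρ S M hM) (Pi.single c 1) b • B c) - R) ∧
      (∀ c : BondIdx (cubeSeqMT3 F n K x ρ S M hM), (c.1.1 : ℕ) = K - n →
        c.1.2.src ∈ (cubeSeqMT3 F n K x ρ S M hM).Om (c.1.1 : ℕ) → c.1.2.tgt ∈ (cubeSeqMT3 F n K x ρ S M hM).Om (c.1.1 : ℕ) →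
        ‖B c‖ ≤ C₁ * ε₁ * (distSite (Mk (F.P K) (c.1.1 : ℕ)) c.1.2.src (iterBlockOf (c.1.1 : ℕ) x) + 1)) ∧
      (∀ c : BondIdx (cubeSeqMT3 F n K x ρ S M hM),
        ¬ ((c.1.1 : ℕ) = K - n ∧ c.1.2.src ∈ (cubeSeqMT3 F n K x ρ S M hM).Om (c.1.1 : ℕ) ∧ c.1.2.tgt ∈ (cubeSeqMT3 F n K x ρ S M hM).Om (c.1.1 : ℕ)) →
        ‖B c‖ ≤ C₂ * ε₀ * (F.L : ℝ) ^ ((K - n) - (c.1.1 : ℕ))) ∧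
      (∀ (z : B7Prop1Explicit.Site (F.P K).d) (τ : Fin (F.P K).d),
        SideTouches (pullDom (fun j => if K - n ≤ j then ({x} : Set (Site (F.P K) 0)) else (∅ : Set (Site (F.P K) 0))) (K - n)) z τ →
        ‖A₁ ⟨transl 0 z, τ⟩‖ ≤ K₁ * ε₀ ^ 2) ∧
      (∀ (z : B7Prop1Explicit.Site (F.P K).d) (κ τ : Fin (F.P K).d),
        SideTouches (pullDom (fun j => if K - n ≤ j then ({x} : Set (Site (F.P K) 0)) else (∅ : Set (Site (F.P K) 0))) (K - n)) z τ →
        ‖(((F.L : ℝ)⁻¹) ^ (K - n))⁻¹ • (A₁ ⟨(transl 0 z).shift κ, τ⟩ - A₁ ⟨transl 0 z, τ⟩)‖ ≤ K₁ * ε₀ ^ 2) ∧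
      (∀ (z : B7Prop1Explicit.Site (F.P K).d) (μ : Fin (F.P K).d),
        BondTouches (pullDom (fun j => if K - n ≤ j then ({x} : Set (Site (F.P K) 0)) else (∅ : Set (Site (F.P K) 0))) (K - n)) z μ →
        ‖pdiv (((F.L : ℝ)⁻¹) ^ (K - n)) (1 : B7Prop1Explicit.Site (F.P K).d → Fin (F.P K).d → (Matrix (Fin 2) (Fin 2) ℂ)ˣ)
            (plaqCovDeriv (((F.L : ℝ)⁻¹) ^ (K - n)) (1 : B7Prop1Explicit.Site (F.P K).d → Fin (F.P K).d → (Matrix (Fin 2) (Fin 2) ℂ)ˣ)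
              (pull A₁ 0)) μ z‖ ≤ K₁ * ε₀ ^ 2) ∧
      (∀ (z : B7Prop1Explicit.Site (F.P K).d) (τ : Fin (F.P K).d),
        SideTouches (pullDom (fun j => if K - n ≤ j then ({x} : Set (Site (F.P K) 0)) else (∅ : Set (Site (F.P K) 0))) (K - n)) z τ →
        ‖R ⟨transl 0 z, τ⟩‖ ≤ K₂ * ε₀ ^ 2) ∧
      (∀ (z : B7Prop1Explicit.Site (F.P K).d) (κ τ : Fin (F.P K).d),
        SideTouches (pullDom (fun j => if K - n ≤ j then ({x} : Set (Site (F.P K) 0)) else (∅ : Set (Site (F.P K) 0))) (K - n)) z τ →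
        ‖(((F.L : ℝ)⁻¹) ^ (K - n))⁻¹ • (R ⟨(transl 0 z).shift κ, τ⟩ - R ⟨transl 0 z, τ⟩)‖ ≤ K₂ * ε₀ ^ 2) ∧
      (∀ (z : B7Prop1Explicit.Site (F.P K).d) (μ : Fin (F.P K).d),
        BondTouches (pullDom (fun j => if K - n ≤ j then ({x} : Set (Site (F.P K) 0)) else (∅ : Set (Site (F.P K) 0))) (K - n)) z μ →
        ‖pdiv (((F.L : ℝ)⁻¹) ^ (K - n)) (1 : B7Prop1Explicit.Site (F.P K).d → Fin (F.P K).d → (Matrix (Fin 2) (Fin 2) ℂ)ˣ)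
            (plaqCovDeriv (((F.L : ℝ)⁻¹) ^ (K - n)) (1 : B7Prop1Explicit.Site (F.P K).d → Fin (F.P K).d → (Matrix (Fin 2) (Fin 2) ℂ)ˣ)
              (pull R 0)) μ z‖ ≤ K₂ * ε₀ ^ 2) := by
  obtain ⟨s₁, g₁, d₁⟩ := h165
  obtain ⟨s₃, g₃, d₃⟩ := h157
  refine ⟨u, A,
    (A + Hs (C A)) - fun b : PBond (F.P K) 0 => ∑ c, flatH F n K (cubeSeqMT3 F n K x ρ S M hM) (Pi.single c 1) b •
      bondAvgIter (c.1.1 : ℕ) (A + Hs (C A)) c.1.2,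
    Hs (C A), fun c => bondAvgIter (c.1.1 : ℕ) (A + Hs (C A)) c.1.2, hA, hchart, ?_, hnear, hfar,
    fun z τ hz => (s₁ z τ hz).trans he₁, fun z κ τ hz => (g₁ z κ τ hz).trans he₁, fun z μ hz => (d₁ z μ hz).trans he₁,
    fun z τ hz => (s₃ z τ hz).trans he₃, fun z κ τ hz => (g₃ z κ τ hz).trans he₃, fun z μ hz => (d₃ z μ hz).trans he₃⟩
  -- `A = (A′ − HM B) + HM B − Hs (C A)` with `A′ = A + Hs (C A)`
  funext b
  simp only [Pi.add_apply, Pi.sub_apply]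
  abel

end Site


/-! ## §2 The (157)-R rows discharged for `R = Hs Y` -/

section R157

variable {F : T3Family} {n K : ℕ}

/-- the level factor of the `Hs` spec is `L^{k−j}`: `(Lʲ·(L⁻¹)ᵏ)⁻¹ = L^{k−j}` for `j ≤ k`. -/
theorem levFactor_inv_eq (L : ℝ) (hL : L ≠ 0) {j k : ℕ} (hjk : j ≤ k) : (L ^ j * (L⁻¹) ^ k)⁻¹ = L ^ (k - j) := by
  rw [inv_pow, mul_inv, inv_inv, ← div_eq_inv_mul, pow_sub₀ L hL hjk, div_eq_mul_inv]

/-- **(157)-R DISCHARGED ON THE CHART OF RECORD**: for the level-scaled extension `Hs` of P2's `flatH` (spec (i) of ✓`FlatHDressingShape.exists_flatH_scaledExt`) and ANY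
index datum `Y` of index-uniform size `‖Y c‖ ≤ t` (B3's hCq♭ letter for `Y = C♭ A`, `t = C₂♭δ²`), the three (157)-R conjuncts of the package hold for `R := Hs Y` with
`e₃ = B₀B₃t` — by ✓`HalvingRRow157.row157_of_kernelDatum` at the weighted-sup datum `X c = L^{k−j(c)}•Y c`. [cite: Balaban1985Variational, (157) p.302, (165) p.304] -/
theorem rRows_scaled_of_uniformDatum (hnK : n < K) (x : Site (F.P K) 0) (ρ S M : ℕ) (hM : 1 ≤ M) (hρ1 : 1 ≤ ρ)
    {w : ℕ → PBond (F.P K) 0 → ℝ} (hw : IsLevWeight F n K (cubeSeqMT3 F n K x ρ S M hM) w)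
    {dBI : PBond (F.P K) 0 → BondIdx (cubeSeqMT3 F n K x ρ S M hM) → ℝ} {δ₀ B₀ B₃ t : ℝ}
    (hH : HDecayLetterD F n K (cubeSeqMT3 F n K x ρ S M hM) dBI w (flatH F n K (cubeSeqMT3 F n K x ρ S M hM)) B₀ δ₀)
    (h162 : RowSum162 F n K (cubeSeqMT3 F n K x ρ S M hM) dBI w δ₀ B₃)
    (hdom : ∀ b c, distBI (cubeSeqMT3 F n K x ρ S M hM) b c ≤ dBI b c) (hδ₀ : 0 ≤ δ₀) (hB₀ : 0 ≤ B₀) (hB₃ : 0 ≤ B₃) (ht : 0 ≤ t)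
    (Hs : (BondIdx (cubeSeqMT3 F n K x ρ S M hM) → Matrix (Fin 2) (Fin 2) ℂ) → (PBond (F.P K) 0 → Matrix (Fin 2) (Fin 2) ℂ))
    (hHs : ∀ X b, Hs X b = ∑ c, (flatH F n K (cubeSeqMT3 F n K x ρ S M hM) (Pi.single c 1) b *
      ((F.L : ℝ) ^ (c.1.1 : ℕ) * ((F.L : ℝ)⁻¹) ^ (K - n))⁻¹) • X c)
    {Y : BondIdx (cubeSeqMT3 F n K x ρ S M hM) → Matrix (Fin 2) (Fin 2) ℂ} (hY : ∀ c, ‖Y c‖ ≤ t) :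
    (∀ (z : B7Prop1Explicit.Site (F.P K).d) (τ : Fin (F.P K).d),
      SideTouches (pullDom (fun j => if K - n ≤ j then ({x} : Set (Site (F.P K) 0)) else (∅ : Set (Site (F.P K) 0))) (K - n)) z τ →
      ‖Hs Y ⟨transl 0 z, τ⟩‖ ≤ B₀ * B₃ * t) ∧
    (∀ (z : B7Prop1Explicit.Site (F.P K).d) (κ τ : Fin (F.P K).d),
      SideTouches (pullDom (fun j => if K - n ≤ j then ({x} : Set (Site (F.P K) 0)) else (∅ : Set (Site (F.P K) 0))) (K - n)) z τ →
      ‖(((F.L : ℝ)⁻¹) ^ (K - n))⁻¹ • (Hs Y ⟨(transl 0 z).shift κ, τ⟩ - Hs Y ⟨transl 0 z, τ⟩)‖ ≤ B₀ * B₃ * t) ∧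
    (∀ (z : B7Prop1Explicit.Site (F.P K).d) (μ : Fin (F.P K).d),
      BondTouches (pullDom (fun j => if K - n ≤ j then ({x} : Set (Site (F.P K) 0)) else (∅ : Set (Site (F.P K) 0))) (K - n)) z μ →
      ‖pdiv (((F.L : ℝ)⁻¹) ^ (K - n)) (1 : B7Prop1Explicit.Site (F.P K).d → Fin (F.P K).d → (Matrix (Fin 2) (Fin 2) ℂ)ˣ)
          (plaqCovDeriv (((F.L : ℝ)⁻¹) ^ (K - n)) (1 : B7Prop1Explicit.Site (F.P K).d → Fin (F.P K).d → (Matrix (Fin 2) (Fin 2) ℂ)ˣ)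
            (pull (Hs Y) 0)) μ z‖ ≤ B₀ * B₃ * t) := by
  have hL0 : (0 : ℝ) < (F.L : ℝ) := by exact_mod_cast (F.P K).L_pos
  -- the weighted-sup datum `X c = L^{k−j(c)} • Y c`
  refine HalvingRRow157.row157_of_kernelDatum hnK x ρ S M hM hρ1 hw hH h162 hdom hδ₀ hB₀ hB₃ ht
    (X := fun c => (((F.L : ℝ) ^ (c.1.1 : ℕ) * ((F.L : ℝ)⁻¹) ^ (K - n))⁻¹) • Y c) (fun b => ?_) (fun c => ?_)
  · rw [hHs Y b]
    refine Finset.sum_congr rfl fun c _ => ?_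
    rw [mul_smul]
  · have hjk : (c.1.1 : ℕ) ≤ K - n := by
      have := c.1.1.isLt
      change (c.1.1 : ℕ) < (K - n) + 1 at this
      omega
    rw [levFactor_inv_eq (F.L : ℝ) hL0.ne' hjk, norm_smul, Real.norm_of_nonneg (by positivity), mul_comm]
    exact mul_le_mul_of_nonneg_right (hY c) (by positivity)

end R157

/-! ## §3 The (165) seam at the structure-literal family -/

section Seam165

open HalvingA1Row165TraceSU2 (row165_of_tracePairing_L5_su2)
open B6SectAOperatorsV1 (QE RE dsE)

/-- **S16 KERNEL-CHECKED**: at `F = ⟨ℓ+1, hL, m, hm⟩`, `M = L·Mh`, the (165)-A₁ supplier of record ✓`row165_of_tracePairing_L5_su2`, read at the chart preimage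
`A′ := A + Hs (C A)` and the current `W`, produces EXACTLY §1's `h165`; with the (157)∕near∕far rows and `e ≤ K₁ε₀²`, `e₃ ≤ K₂ε₀²` the package body follows.  Displayed: every
input of the (165) row ((i) pairing, (ii) slice, (iii) (98), (iv) sizes, tr∕sa of `A′`, numerics, member side conditions `4 ≤ ℓ`, `a′+3 ≤ m+n`).
[cite: Balaban1985Variational, (152)-(157) pp.301-302, (165) p.304] -/
theorem sitePackage_of_rows_L5 (ℓ : ℕ) (hL : Odd (ℓ + 1) ∧ 1 < ℓ + 1) (hℓ : 4 ≤ ℓ) :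
    ∃ (Mh₀ R₀ : ℕ) (B₀ BM : ℝ), 0 ≤ B₀ ∧ 0 ≤ BM ∧
    ∀ (m : ℕ) (hm : 1 ≤ m) (n K : ℕ) (_ : 1 ≤ K - n) (_ : K - n + 1 ≤ m + K) {Mh R a' : ℕ} (_ : Mh = (ℓ + 1) ^ a') (_ : Mh₀ ≤ Mh) (_ : R₀ ≤ R)
      (_ : a' + 3 ≤ m + n) (hM1 : 1 ≤ (ℓ + 1) * Mh) (x₀ : Site ((⟨ℓ + 1, hL, m, hm⟩ : T3Family).P K) 0) (ρ S : ℕ) (_ : R * ((ℓ + 1) * Mh) ≤ S) (_ : 1 ≤ ρ)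
      (w : ℕ → PBond ((⟨ℓ + 1, hL, m, hm⟩ : T3Family).P K) 0 → ℝ) (_ : IsLevWeight (⟨ℓ + 1, hL, m, hm⟩ : T3Family) n K (cubeSeqMT3 (⟨ℓ + 1, hL, m, hm⟩ : T3Family) n K x₀ ρ S ((ℓ + 1) * Mh) hM1) w)
      (U : GaugeField ((⟨ℓ + 1, hL, m, hm⟩ : T3Family).P K) 0 (Matrix.specialUnitaryGroup (Fin 2) ℂ)) (u : GaugeTransf ((⟨ℓ + 1, hL, m, hm⟩ : T3Family).P K) 0 (Matrix.unitaryGroup (Fin 2) ℂ))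
      (A : PBond ((⟨ℓ + 1, hL, m, hm⟩ : T3Family).P K) 0 → Matrix (Fin 2) (Fin 2) ℂ) (Hs : (BondIdx (cubeSeqMT3 (⟨ℓ + 1, hL, m, hm⟩ : T3Family) n K x₀ ρ S ((ℓ + 1) * Mh) hM1) → Matrix (Fin 2) (Fin 2) ℂ) → (PBond ((⟨ℓ + 1, hL, m, hm⟩ : T3Family).P K) 0 → Matrix (Fin 2) (Fin 2) ℂ))
      (C : (PBond ((⟨ℓ + 1, hL, m, hm⟩ : T3Family).P K) 0 → Matrix (Fin 2) (Fin 2) ℂ) → (BondIdx (cubeSeqMT3 (⟨ℓ + 1, hL, m, hm⟩ : T3Family) n K x₀ ρ S ((ℓ + 1) * Mh) hM1) → Matrix (Fin 2) (Fin 2) ℂ))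
      (_ : ∀ b, IsSelfAdjoint (A b))
      (_ : ∀ (z : B7Prop1Explicit.Site ((⟨ℓ + 1, hL, m, hm⟩ : T3Family).P K).d) (μ : Fin ((⟨ℓ + 1, hL, m, hm⟩ : T3Family).P K).d), SideTouches (pullDom (fun j => if K - n ≤ j then ({x₀} : Set (Site ((⟨ℓ + 1, hL, m, hm⟩ : T3Family).P K) 0)) else (∅ : Set (Site ((⟨ℓ + 1, hL, m, hm⟩ : T3Family).P K) 0))) (K - n)) z μ →
        (Unitary.toUnits (u (transl 0 z)))⁻¹ * unitsField (toUField U) ⟨transl 0 z, μ⟩ * Unitary.toUnits (u ((transl 0 z).shift μ)) =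
          expUnit (I • (((((⟨ℓ + 1, hL, m, hm⟩ : T3Family).L : ℝ)⁻¹) ^ (K - n)) • A ⟨transl 0 z, μ⟩)))
      (_ : ∀ b, IsSelfAdjoint ((A + Hs (C A)) b)) (_ : ∀ b, Matrix.trace ((A + Hs (C A)) b) = 0)
      (W : (PBond ((⟨ℓ + 1, hL, m, hm⟩ : T3Family).P K) 0 → Matrix (Fin 2) (Fin 2) ℂ) → (PBond ((⟨ℓ + 1, hL, m, hm⟩ : T3Family).P K) 0 → Matrix (Fin 2) (Fin 2) ℂ)) {C₄ a₃ r e ε₀ ε₁ C₁ C₂ K₁ K₂ e₃ : ℝ}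
      (_ : ∀ (Y : PBond ((⟨ℓ + 1, hL, m, hm⟩ : T3Family).P K) 0 → Matrix (Fin 2) (Fin 2) ℂ) (r' : ℝ), r' < a₃ → (∀ b, w 1 b * ‖Y b‖ ≤ r') →
        (∀ (b : PBond ((⟨ℓ + 1, hL, m, hm⟩ : T3Family).P K) 0) (ν : Fin 3), w 2 b * (((ℓ + 1 : ℕ) : ℝ)) ^ (K - n) * ‖Y ⟨b.src.shift ν, b.dir⟩ - Y b‖ ≤ r') →
        ∀ b, w 3 b * ‖W Y b‖ ≤ C₄ * r' ^ 2)
      (_ : ∀ s : PBond ((⟨ℓ + 1, hL, m, hm⟩ : T3Family).P K) 0 → ℝ, QE (cubeSeqMT3 (⟨ℓ + 1, hL, m, hm⟩ : T3Family) n K x₀ ρ S ((ℓ + 1) * Mh) hM1) (WithLp.toLp 2 s) = 0 →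
        ∀ E : Matrix (Fin 2) (Fin 2) ℂ, IsSelfAdjoint E → Matrix.trace E = 0 →
        (((((((ℓ + 1 : ℕ) : ℝ)⁻¹) ^ (K - n) : ℝ) : ℂ) ^ 2 / 2) *
            ∑ p : Plaq ((⟨ℓ + 1, hL, m, hm⟩ : T3Family).P K) 0, Matrix.trace (((A + Hs (C A)) ⟨p.src, p.μ⟩ + (A + Hs (C A)) ⟨p.src.shift p.μ, p.ν⟩ - (A + Hs (C A)) ⟨p.src.shift p.ν, p.μ⟩ - (A + Hs (C A)) ⟨p.src, p.ν⟩) *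
              (((s ⟨p.src, p.μ⟩ : ℝ) : ℂ) • E + ((s ⟨p.src.shift p.μ, p.ν⟩ : ℝ) : ℂ) • E - ((s ⟨p.src.shift p.ν, p.μ⟩ : ℝ) : ℂ) • E -
                ((s ⟨p.src, p.ν⟩ : ℝ) : ℂ) • E)) +
          (((((ℓ + 1 : ℕ) : ℝ)⁻¹) ^ (K - n) : ℝ) : ℂ) ^ 4 * ∑ b : PBond ((⟨ℓ + 1, hL, m, hm⟩ : T3Family).P K) 0, Matrix.trace (W (A + Hs (C A)) b * (((s b : ℝ) : ℂ) • E))).re = 0)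
      (_ : ∀ φ : Matrix (Fin 2) (Fin 2) ℂ →ₗ[ℝ] ℝ,
        RE (cubeSeqMT3 (⟨ℓ + 1, hL, m, hm⟩ : T3Family) n K x₀ ρ S ((ℓ + 1) * Mh) hM1) ((((ℓ + 1 : ℕ) : ℝ)) ^ (K - n)) (dsE ((((ℓ + 1 : ℕ) : ℝ)) ^ (K - n)) (WithLp.toLp 2 (fun b => φ ((A + Hs (C A)) b)))) = 0)
      (_ : r < a₃) (_ : ∀ b, w 1 b * ‖(A + Hs (C A)) b‖ ≤ r)
      (_ : ∀ (b : PBond ((⟨ℓ + 1, hL, m, hm⟩ : T3Family).P K) 0) (ν : Fin 3), w 2 b * (((ℓ + 1 : ℕ) : ℝ)) ^ (K - n) * ‖(A + Hs (C A)) ⟨b.src.shift ν, b.dir⟩ - (A + Hs (C A)) b‖ ≤ r)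
      (_ : B₀ * (4 * C₄ * r ^ 2) ≤ e) (_ : (1 + BM) * (4 * C₄ * r ^ 2) ≤ e) (_ : e ≤ K₁ * ε₀ ^ 2)
      (_ : (∀ (z : B7Prop1Explicit.Site ((⟨ℓ + 1, hL, m, hm⟩ : T3Family).P K).d) (τ : Fin ((⟨ℓ + 1, hL, m, hm⟩ : T3Family).P K).d), SideTouches (pullDom (fun j => if K - n ≤ j then ({x₀} : Set (Site ((⟨ℓ + 1, hL, m, hm⟩ : T3Family).P K) 0)) else (∅ : Set (Site ((⟨ℓ + 1, hL, m, hm⟩ : T3Family).P K) 0))) (K - n)) z τ → ‖Hs (C A) ⟨transl 0 z, τ⟩‖ ≤ e₃) ∧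
        (∀ (z : B7Prop1Explicit.Site ((⟨ℓ + 1, hL, m, hm⟩ : T3Family).P K).d) (κ τ : Fin ((⟨ℓ + 1, hL, m, hm⟩ : T3Family).P K).d), SideTouches (pullDom (fun j => if K - n ≤ j then ({x₀} : Set (Site ((⟨ℓ + 1, hL, m, hm⟩ : T3Family).P K) 0)) else (∅ : Set (Site ((⟨ℓ + 1, hL, m, hm⟩ : T3Family).P K) 0))) (K - n)) z τ →
          ‖(((((⟨ℓ + 1, hL, m, hm⟩ : T3Family).L : ℝ)⁻¹) ^ (K - n)))⁻¹ • (Hs (C A) ⟨(transl 0 z).shift κ, τ⟩ - Hs (C A) ⟨transl 0 z, τ⟩)‖ ≤ e₃) ∧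
        (∀ (z : B7Prop1Explicit.Site ((⟨ℓ + 1, hL, m, hm⟩ : T3Family).P K).d) (μ : Fin ((⟨ℓ + 1, hL, m, hm⟩ : T3Family).P K).d), BondTouches (pullDom (fun j => if K - n ≤ j then ({x₀} : Set (Site ((⟨ℓ + 1, hL, m, hm⟩ : T3Family).P K) 0)) else (∅ : Set (Site ((⟨ℓ + 1, hL, m, hm⟩ : T3Family).P K) 0))) (K - n)) z μ →
          ‖pdiv ((((⟨ℓ + 1, hL, m, hm⟩ : T3Family).L : ℝ)⁻¹) ^ (K - n)) (1 : B7Prop1Explicit.Site ((⟨ℓ + 1, hL, m, hm⟩ : T3Family).P K).d → Fin ((⟨ℓ + 1, hL, m, hm⟩ : T3Family).P K).d → (Matrix (Fin 2) (Fin 2) ℂ)ˣ)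
              (plaqCovDeriv ((((⟨ℓ + 1, hL, m, hm⟩ : T3Family).L : ℝ)⁻¹) ^ (K - n)) (1 : B7Prop1Explicit.Site ((⟨ℓ + 1, hL, m, hm⟩ : T3Family).P K).d → Fin ((⟨ℓ + 1, hL, m, hm⟩ : T3Family).P K).d → (Matrix (Fin 2) (Fin 2) ℂ)ˣ) (pull (Hs (C A)) 0)) μ z‖ ≤ e₃))
      (_ : ∀ c : BondIdx (cubeSeqMT3 (⟨ℓ + 1, hL, m, hm⟩ : T3Family) n K x₀ ρ S ((ℓ + 1) * Mh) hM1), (c.1.1 : ℕ) = K - n → c.1.2.src ∈ (cubeSeqMT3 (⟨ℓ + 1, hL, m, hm⟩ : T3Family) n K x₀ ρ S ((ℓ + 1) * Mh) hM1).Om (c.1.1 : ℕ) → c.1.2.tgt ∈ (cubeSeqMT3 (⟨ℓ + 1, hL, m, hm⟩ : T3Family) n K x₀ ρ S ((ℓ + 1) * Mh) hM1).Om (c.1.1 : ℕ) →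
        ‖bondAvgIter (c.1.1 : ℕ) (A + Hs (C A)) c.1.2‖ ≤ C₁ * ε₁ * (distSite (Mk ((⟨ℓ + 1, hL, m, hm⟩ : T3Family).P K) (c.1.1 : ℕ)) c.1.2.src (iterBlockOf (c.1.1 : ℕ) x₀) + 1))
      (_ : ∀ c : BondIdx (cubeSeqMT3 (⟨ℓ + 1, hL, m, hm⟩ : T3Family) n K x₀ ρ S ((ℓ + 1) * Mh) hM1), ¬ ((c.1.1 : ℕ) = K - n ∧ c.1.2.src ∈ (cubeSeqMT3 (⟨ℓ + 1, hL, m, hm⟩ : T3Family) n K x₀ ρ S ((ℓ + 1) * Mh) hM1).Om (c.1.1 : ℕ) ∧ c.1.2.tgt ∈ (cubeSeqMT3 (⟨ℓ + 1, hL, m, hm⟩ : T3Family) n K x₀ ρ S ((ℓ + 1) * Mh) hM1).Om (c.1.1 : ℕ)) →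
        ‖bondAvgIter (c.1.1 : ℕ) (A + Hs (C A)) c.1.2‖ ≤ C₂ * ε₀ * ((⟨ℓ + 1, hL, m, hm⟩ : T3Family).L : ℝ) ^ ((K - n) - (c.1.1 : ℕ)))
      (_ : e₃ ≤ K₂ * ε₀ ^ 2),
    ∃ (u : GaugeTransf ((⟨ℓ + 1, hL, m, hm⟩ : T3Family).P K) 0 (Matrix.unitaryGroup (Fin 2) ℂ)) (A A₁ R : PBond ((⟨ℓ + 1, hL, m, hm⟩ : T3Family).P K) 0 → Matrix (Fin 2) (Fin 2) ℂ) (B : BondIdx (cubeSeqMT3 (⟨ℓ + 1, hL, m, hm⟩ : T3Family) n K x₀ ρ S ((ℓ + 1) * Mh) hM1) → Matrix (Fin 2) (Fin 2) ℂ),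
      (∀ b : PBond ((⟨ℓ + 1, hL, m, hm⟩ : T3Family).P K) 0, IsSelfAdjoint (A b)) ∧
      (∀ (z : B7Prop1Explicit.Site ((⟨ℓ + 1, hL, m, hm⟩ : T3Family).P K).d) (μ : Fin ((⟨ℓ + 1, hL, m, hm⟩ : T3Family).P K).d), SideTouches (pullDom (fun j => if K - n ≤ j then ({x₀} : Set (Site ((⟨ℓ + 1, hL, m, hm⟩ : T3Family).P K) 0)) else (∅ : Set (Site ((⟨ℓ + 1, hL, m, hm⟩ : T3Family).P K) 0))) (K - n)) z μ →
        (Unitary.toUnits (u (transl 0 z)))⁻¹ * unitsField (toUField U) ⟨transl 0 z, μ⟩ * Unitary.toUnits (u ((transl 0 z).shift μ)) =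
          expUnit (I • (((((⟨ℓ + 1, hL, m, hm⟩ : T3Family).L : ℝ)⁻¹) ^ (K - n)) • A ⟨transl 0 z, μ⟩))) ∧
      (A = A₁ + (fun b : PBond ((⟨ℓ + 1, hL, m, hm⟩ : T3Family).P K) 0 => ∑ c, flatH (⟨ℓ + 1, hL, m, hm⟩ : T3Family) n K (cubeSeqMT3 (⟨ℓ + 1, hL, m, hm⟩ : T3Family) n K x₀ ρ S ((ℓ + 1) * Mh) hM1) (Pi.single c 1) b • B c) - R) ∧
      (∀ c : BondIdx (cubeSeqMT3 (⟨ℓ + 1, hL, m, hm⟩ : T3Family) n K x₀ ρ S ((ℓ + 1) * Mh) hM1), (c.1.1 : ℕ) = K - n → c.1.2.src ∈ (cubeSeqMT3 (⟨ℓ + 1, hL, m, hm⟩ : T3Family) n K x₀ ρ S ((ℓ + 1) * Mh) hM1).Om (c.1.1 : ℕ) → c.1.2.tgt ∈ (cubeSeqMT3 (⟨ℓ + 1, hL, m, hm⟩ : T3Family) n K x₀ ρ S ((ℓ + 1) * Mh) hM1).Om (c.1.1 : ℕ) →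
        ‖B c‖ ≤ C₁ * ε₁ * (distSite (Mk ((⟨ℓ + 1, hL, m, hm⟩ : T3Family).P K) (c.1.1 : ℕ)) c.1.2.src (iterBlockOf (c.1.1 : ℕ) x₀) + 1)) ∧
      (∀ c : BondIdx (cubeSeqMT3 (⟨ℓ + 1, hL, m, hm⟩ : T3Family) n K x₀ ρ S ((ℓ + 1) * Mh) hM1), ¬ ((c.1.1 : ℕ) = K - n ∧ c.1.2.src ∈ (cubeSeqMT3 (⟨ℓ + 1, hL, m, hm⟩ : T3Family) n K x₀ ρ S ((ℓ + 1) * Mh) hM1).Om (c.1.1 : ℕ) ∧ c.1.2.tgt ∈ (cubeSeqMT3 (⟨ℓ + 1, hL, m, hm⟩ : T3Family) n K x₀ ρ S ((ℓ + 1) * Mh) hM1).Om (c.1.1 : ℕ)) →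
        ‖B c‖ ≤ C₂ * ε₀ * ((⟨ℓ + 1, hL, m, hm⟩ : T3Family).L : ℝ) ^ ((K - n) - (c.1.1 : ℕ))) ∧
      (∀ (z : B7Prop1Explicit.Site ((⟨ℓ + 1, hL, m, hm⟩ : T3Family).P K).d) (τ : Fin ((⟨ℓ + 1, hL, m, hm⟩ : T3Family).P K).d), SideTouches (pullDom (fun j => if K - n ≤ j then ({x₀} : Set (Site ((⟨ℓ + 1, hL, m, hm⟩ : T3Family).P K) 0)) else (∅ : Set (Site ((⟨ℓ + 1, hL, m, hm⟩ : T3Family).P K) 0))) (K - n)) z τ → ‖A₁ ⟨transl 0 z, τ⟩‖ ≤ K₁ * ε₀ ^ 2) ∧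
      (∀ (z : B7Prop1Explicit.Site ((⟨ℓ + 1, hL, m, hm⟩ : T3Family).P K).d) (κ τ : Fin ((⟨ℓ + 1, hL, m, hm⟩ : T3Family).P K).d), SideTouches (pullDom (fun j => if K - n ≤ j then ({x₀} : Set (Site ((⟨ℓ + 1, hL, m, hm⟩ : T3Family).P K) 0)) else (∅ : Set (Site ((⟨ℓ + 1, hL, m, hm⟩ : T3Family).P K) 0))) (K - n)) z τ →
        ‖(((((⟨ℓ + 1, hL, m, hm⟩ : T3Family).L : ℝ)⁻¹) ^ (K - n)))⁻¹ • (A₁ ⟨(transl 0 z).shift κ, τ⟩ - A₁ ⟨transl 0 z, τ⟩)‖ ≤ K₁ * ε₀ ^ 2) ∧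
      (∀ (z : B7Prop1Explicit.Site ((⟨ℓ + 1, hL, m, hm⟩ : T3Family).P K).d) (μ : Fin ((⟨ℓ + 1, hL, m, hm⟩ : T3Family).P K).d), BondTouches (pullDom (fun j => if K - n ≤ j then ({x₀} : Set (Site ((⟨ℓ + 1, hL, m, hm⟩ : T3Family).P K) 0)) else (∅ : Set (Site ((⟨ℓ + 1, hL, m, hm⟩ : T3Family).P K) 0))) (K - n)) z μ →
        ‖pdiv ((((⟨ℓ + 1, hL, m, hm⟩ : T3Family).L : ℝ)⁻¹) ^ (K - n)) (1 : B7Prop1Explicit.Site ((⟨ℓ + 1, hL, m, hm⟩ : T3Family).P K).d → Fin ((⟨ℓ + 1, hL, m, hm⟩ : T3Family).P K).d → (Matrix (Fin 2) (Fin 2) ℂ)ˣ)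
            (plaqCovDeriv ((((⟨ℓ + 1, hL, m, hm⟩ : T3Family).L : ℝ)⁻¹) ^ (K - n)) (1 : B7Prop1Explicit.Site ((⟨ℓ + 1, hL, m, hm⟩ : T3Family).P K).d → Fin ((⟨ℓ + 1, hL, m, hm⟩ : T3Family).P K).d → (Matrix (Fin 2) (Fin 2) ℂ)ˣ) (pull A₁ 0)) μ z‖ ≤ K₁ * ε₀ ^ 2) ∧
      (∀ (z : B7Prop1Explicit.Site ((⟨ℓ + 1, hL, m, hm⟩ : T3Family).P K).d) (τ : Fin ((⟨ℓ + 1, hL, m, hm⟩ : T3Family).P K).d), SideTouches (pullDom (fun j => if K - n ≤ j then ({x₀} : Set (Site ((⟨ℓ + 1, hL, m, hm⟩ : T3Family).P K) 0)) else (∅ : Set (Site ((⟨ℓ + 1, hL, m, hm⟩ : T3Family).P K) 0))) (K - n)) z τ → ‖R ⟨transl 0 z, τ⟩‖ ≤ K₂ * ε₀ ^ 2) ∧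
      (∀ (z : B7Prop1Explicit.Site ((⟨ℓ + 1, hL, m, hm⟩ : T3Family).P K).d) (κ τ : Fin ((⟨ℓ + 1, hL, m, hm⟩ : T3Family).P K).d), SideTouches (pullDom (fun j => if K - n ≤ j then ({x₀} : Set (Site ((⟨ℓ + 1, hL, m, hm⟩ : T3Family).P K) 0)) else (∅ : Set (Site ((⟨ℓ + 1, hL, m, hm⟩ : T3Family).P K) 0))) (K - n)) z τ →
        ‖(((((⟨ℓ + 1, hL, m, hm⟩ : T3Family).L : ℝ)⁻¹) ^ (K - n)))⁻¹ • (R ⟨(transl 0 z).shift κ, τ⟩ - R ⟨transl 0 z, τ⟩)‖ ≤ K₂ * ε₀ ^ 2) ∧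
      (∀ (z : B7Prop1Explicit.Site ((⟨ℓ + 1, hL, m, hm⟩ : T3Family).P K).d) (μ : Fin ((⟨ℓ + 1, hL, m, hm⟩ : T3Family).P K).d), BondTouches (pullDom (fun j => if K - n ≤ j then ({x₀} : Set (Site ((⟨ℓ + 1, hL, m, hm⟩ : T3Family).P K) 0)) else (∅ : Set (Site ((⟨ℓ + 1, hL, m, hm⟩ : T3Family).P K) 0))) (K - n)) z μ →
        ‖pdiv ((((⟨ℓ + 1, hL, m, hm⟩ : T3Family).L : ℝ)⁻¹) ^ (K - n)) (1 : B7Prop1Explicit.Site ((⟨ℓ + 1, hL, m, hm⟩ : T3Family).P K).d → Fin ((⟨ℓ + 1, hL, m, hm⟩ : T3Family).P K).d → (Matrix (Fin 2) (Fin 2) ℂ)ˣ)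
            (plaqCovDeriv ((((⟨ℓ + 1, hL, m, hm⟩ : T3Family).L : ℝ)⁻¹) ^ (K - n)) (1 : B7Prop1Explicit.Site ((⟨ℓ + 1, hL, m, hm⟩ : T3Family).P K).d → Fin ((⟨ℓ + 1, hL, m, hm⟩ : T3Family).P K).d → (Matrix (Fin 2) (Fin 2) ℂ)ˣ) (pull R 0)) μ z‖ ≤ K₂ * ε₀ ^ 2) := by
  obtain ⟨Mh₀, R₀, B₀, BM, hB₀, hBM, hmain⟩ := row165_of_tracePairing_L5_su2 ℓ hL hℓ
  refine ⟨Mh₀, R₀, B₀, BM, hB₀, hBM, ?_⟩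
  intro m hm n K hk1 hk' Mh R a' hMha hMh hR hsize hM1 x₀ ρ S hRS hρ1 w hw U u A Hs C hA hchart hA'sa hA'tr W C₄ a₃ r e ε₀ ε₁ C₁ C₂ K₁ K₂ e₃
    hWq hpair hslice hr h1 h2 he₁' he₂' he₁ h157 hnear hfar he₃
  have h165 := hmain m hm n K hk1 hk' hMha hMh hR hsize hM1 x₀ ρ S hRS hρ1 w hw (A + Hs (C A)) hA'sa hA'tr W hWq hpair hslice hr h1 h2 he₁' he₂'
  exact sitePackage_of_rows (F := (⟨ℓ + 1, hL, m, hm⟩ : T3Family)) x₀ ρ S ((ℓ + 1) * Mh) hM1 U u A Hs C hA hchart h165 h157 hnear hfar he₁ he₃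

end Seam165

/-! ## §4 The registered text from the P2 text and per-site rows -/

section Top

/-- **THE REGISTERED TEXT OF `BirthV10.stub_halvingStep` (verbatim) FROM THE P2 TEXT AND PER-SITE ROWS** — `stubText_of_packageInt_largeRho` ∘ §1: at every
site the hypothesis asks for the P1 chart pair `(u, A)`, some `Hs`, some remainder map `C`, and bounds `e₁ ≤ K₁ε₀²`, `e₃ ≤ K₂ε₀²` carrying the (165)-A₁, (157)-R,
(160)-near and (155)-far ROWS of `A′ = A + Hs (C A)`. [cite: Balaban1985Variational, (152)-(168) pp.301-304, Prop. 8 p.304] -/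
theorem stubText_of_siteRows
    (h : ∀ L : ℕ, 1 < L → ∃ (R₀ M₀ : ℕ) (B₀ δ₀ B₃ : ℝ), 0 ≤ B₀ ∧ 0 < δ₀ ∧ 0 ≤ B₃ ∧ FlatOpsAdmAtMS L R₀ M₀ B₀ δ₀ B₃ ∧
      ∃ (R M aₑ S : ℕ) (hM1 : 1 ≤ M) (C' C₁ C₂ K₁ K₂ a : ℝ), R₀ ≤ R ∧ M₀ ≤ M ∧ M = L ^ aₑ ∧ R * M ≤ S ∧
        0 ≤ C₁ ∧ 2 * C₁ ≤ C' ∧ C₂ ≤ C' ∧ 0 ≤ K₁ ∧ 0 ≤ K₂ ∧ 0 < a ∧ 1 < C' * B₀ * B₃ ∧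
        ∀ ρ : ℕ, (2 : ℝ) ≤ (ρ : ℝ) →
          ∀ F : T3Family, F.L = L → ∀ (n K : ℕ) (hnK : n < K) (ε₀ ε₁ : ℝ), 0 < ε₁ → 0 < ε₀ → ε₀ ≤ a → 4 * C' * B₀ * B₃ * ε₁ < ε₀ →
            ∀ V : GaugeField (F.P n) 0 (Matrix.specialUnitaryGroup (Fin 2) ℂ), PlaqSmall ε₁ V →
              ∀ U ∈ regFibrePr F n K hnK.le ε₀ V,
                IsMinOn (fun W : GaugeField (F.P K) 0 (Matrix.specialUnitaryGroup (Fin 2) ℂ) => wilsonAction4 W) (regFibrePr F n K hnK.le ε₀ V) U →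
                ∀ x : Site (F.P K) 0,
                  ∃ (u : GaugeTransf (F.P K) 0 (Matrix.unitaryGroup (Fin 2) ℂ)) (A : PBond (F.P K) 0 → Matrix (Fin 2) (Fin 2) ℂ)
                    (Hs : (BondIdx (cubeSeqMT3 F n K x ρ S M hM1) → Matrix (Fin 2) (Fin 2) ℂ) → (PBond (F.P K) 0 → Matrix (Fin 2) (Fin 2) ℂ))
                    (C : (PBond (F.P K) 0 → Matrix (Fin 2) (Fin 2) ℂ) → (BondIdx (cubeSeqMT3 F n K x ρ S M hM1) → Matrix (Fin 2) (Fin 2) ℂ))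
                    (e₁ e₃ : ℝ),
                    (∀ b : PBond (F.P K) 0, IsSelfAdjoint (A b)) ∧
                    (∀ (z : B7Prop1Explicit.Site (F.P K).d) (μ : Fin (F.P K).d), SideTouches (pullDom (fun j => if K - n ≤ j then ({x} : Set (Site (F.P K) 0)) else (∅ : Set (Site (F.P K) 0))) (K - n)) z μ →
                      (Unitary.toUnits (u (transl 0 z)))⁻¹ * unitsField (toUField U) ⟨transl 0 z, μ⟩ * Unitary.toUnits (u ((transl 0 z).shift μ)) =
                        expUnit (I • ((((F.L : ℝ)⁻¹) ^ (K - n)) • A ⟨transl 0 z, μ⟩))) ∧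
                    ((∀ (z : B7Prop1Explicit.Site (F.P K).d) (τ : Fin (F.P K).d), SideTouches (pullDom (fun j => if K - n ≤ j then ({x} : Set (Site (F.P K) 0)) else (∅ : Set (Site (F.P K) 0))) (K - n)) z τ →
                        ‖((A + Hs (C A)) - fun b : PBond (F.P K) 0 => ∑ c, flatH F n K (cubeSeqMT3 F n K x ρ S M hM1) (Pi.single c 1) b •
                            bondAvgIter (c.1.1 : ℕ) (A + Hs (C A)) c.1.2) ⟨transl 0 z, τ⟩‖ ≤ e₁) ∧
                      (∀ (z : B7Prop1Explicit.Site (F.P K).d) (κ τ : Fin (F.P K).d), SideTouches (pullDom (fun j => if K - n ≤ j then ({x} : Set (Site (F.P K) 0)) else (∅ : Set (Site (F.P K) 0))) (K - n)) z τ →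
                        ‖(((F.L : ℝ)⁻¹) ^ (K - n))⁻¹ •
                          (((A + Hs (C A)) - fun b : PBond (F.P K) 0 => ∑ c, flatH F n K (cubeSeqMT3 F n K x ρ S M hM1) (Pi.single c 1) b •
                              bondAvgIter (c.1.1 : ℕ) (A + Hs (C A)) c.1.2) ⟨(transl 0 z).shift κ, τ⟩ -
                            ((A + Hs (C A)) - fun b : PBond (F.P K) 0 => ∑ c, flatH F n K (cubeSeqMT3 F n K x ρ S M hM1) (Pi.single c 1) b •
                              bondAvgIter (c.1.1 : ℕ) (A + Hs (C A)) c.1.2) ⟨transl 0 z, τ⟩)‖ ≤ e₁) ∧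
                      (∀ (z : B7Prop1Explicit.Site (F.P K).d) (μ : Fin (F.P K).d), BondTouches (pullDom (fun j => if K - n ≤ j then ({x} : Set (Site (F.P K) 0)) else (∅ : Set (Site (F.P K) 0))) (K - n)) z μ →
                        ‖pdiv (((F.L : ℝ)⁻¹) ^ (K - n)) (1 : B7Prop1Explicit.Site (F.P K).d → Fin (F.P K).d → (Matrix (Fin 2) (Fin 2) ℂ)ˣ)
                            (plaqCovDeriv (((F.L : ℝ)⁻¹) ^ (K - n)) (1 : B7Prop1Explicit.Site (F.P K).d → Fin (F.P K).d → (Matrix (Fin 2) (Fin 2) ℂ)ˣ)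
                              (pull ((A + Hs (C A)) - fun b : PBond (F.P K) 0 => ∑ c, flatH F n K (cubeSeqMT3 F n K x ρ S M hM1) (Pi.single c 1) b •
                                bondAvgIter (c.1.1 : ℕ) (A + Hs (C A)) c.1.2) 0)) μ z‖ ≤ e₁)) ∧
                    ((∀ (z : B7Prop1Explicit.Site (F.P K).d) (τ : Fin (F.P K).d), SideTouches (pullDom (fun j => if K - n ≤ j then ({x} : Set (Site (F.P K) 0)) else (∅ : Set (Site (F.P K) 0))) (K - n)) z τ →
                        ‖Hs (C A) ⟨transl 0 z, τ⟩‖ ≤ e₃) ∧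
                      (∀ (z : B7Prop1Explicit.Site (F.P K).d) (κ τ : Fin (F.P K).d), SideTouches (pullDom (fun j => if K - n ≤ j then ({x} : Set (Site (F.P K) 0)) else (∅ : Set (Site (F.P K) 0))) (K - n)) z τ →
                        ‖(((F.L : ℝ)⁻¹) ^ (K - n))⁻¹ • (Hs (C A) ⟨(transl 0 z).shift κ, τ⟩ - Hs (C A) ⟨transl 0 z, τ⟩)‖ ≤ e₃) ∧
                      (∀ (z : B7Prop1Explicit.Site (F.P K).d) (μ : Fin (F.P K).d), BondTouches (pullDom (fun j => if K - n ≤ j then ({x} : Set (Site (F.P K) 0)) else (∅ : Set (Site (F.P K) 0))) (K - n)) z μ →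
                        ‖pdiv (((F.L : ℝ)⁻¹) ^ (K - n)) (1 : B7Prop1Explicit.Site (F.P K).d → Fin (F.P K).d → (Matrix (Fin 2) (Fin 2) ℂ)ˣ)
                            (plaqCovDeriv (((F.L : ℝ)⁻¹) ^ (K - n)) (1 : B7Prop1Explicit.Site (F.P K).d → Fin (F.P K).d → (Matrix (Fin 2) (Fin 2) ℂ)ˣ)
                              (pull (Hs (C A)) 0)) μ z‖ ≤ e₃)) ∧
                    (∀ c : BondIdx (cubeSeqMT3 F n K x ρ S M hM1), (c.1.1 : ℕ) = K - n →
                      c.1.2.src ∈ (cubeSeqMT3 F n K x ρ S M hM1).Om (c.1.1 : ℕ) → c.1.2.tgt ∈ (cubeSeqMT3 F n K x ρ S M hM1).Om (c.1.1 : ℕ) →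
                      ‖bondAvgIter (c.1.1 : ℕ) (A + Hs (C A)) c.1.2‖ ≤ C₁ * ε₁ * (distSite (Mk (F.P K) (c.1.1 : ℕ)) c.1.2.src (iterBlockOf (c.1.1 : ℕ) x) + 1)) ∧
                    (∀ c : BondIdx (cubeSeqMT3 F n K x ρ S M hM1),
                      ¬ ((c.1.1 : ℕ) = K - n ∧ c.1.2.src ∈ (cubeSeqMT3 F n K x ρ S M hM1).Om (c.1.1 : ℕ) ∧ c.1.2.tgt ∈ (cubeSeqMT3 F n K x ρ S M hM1).Om (c.1.1 : ℕ)) →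
                      ‖bondAvgIter (c.1.1 : ℕ) (A + Hs (C A)) c.1.2‖ ≤ C₂ * ε₀ * (F.L : ℝ) ^ ((K - n) - (c.1.1 : ℕ))) ∧
                    e₁ ≤ K₁ * ε₀ ^ 2 ∧ e₃ ≤ K₂ * ε₀ ^ 2) :
    ∀ (L : ℕ), 1 < L → ∃ B₃ : ℝ, 4 < B₃ ∧ ∃ a₅ : ℝ, 0 < a₅ ∧
      ∀ (i : Idx L) (ε₀ ε₁ : ℝ), 0 < ε₁ → ∀ (V : (famX L i).Bdry) (U : (famX L i).Cfg), (famX L i).Reg7 ε₁ V → (famX L i).InU ε₀ U →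
        (famX L i).InB V U → (famX L i).IsCritical V U → ε₀ ≤ a₅ → (famX L i).InU (max (B₃ * ε₁) (ε₀ / 2)) U := by
  refine HalvingAssemblyInterior.stubText_of_packageInt_largeRho fun L hL => ?_
  obtain ⟨R₀, M₀, B₀, δ₀, B₃, hB₀, hδ₀, hB₃, hP2, R, M, aₑ, S, hM1, C', C₁, C₂, K₁, K₂, a, hR, hM₀, hMpow, hRS, hC₁, hC₁C, hC₂C, hK₁, hK₂,
    ha, hbig, rows⟩ := h L hL
  refine ⟨R₀, M₀, B₀, δ₀, B₃, hB₀, hδ₀, hB₃, hP2, R, M, aₑ, S, hM1, C', C₁, C₂, K₁, K₂, a, hR, hM₀, hMpow, hRS, hC₁, hC₁C, hC₂C, hK₁, hK₂,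
    ha, hbig, fun ρ hρ F hF n K hnK ε₀ ε₁ hε₁ hε₀ hε₀a hreg V hV U hU hmin x => ?_⟩
  obtain ⟨u, A, Hs, C, e₁, e₃, hA, hchart, h165, h157, hnear, hfar, he₁, he₃⟩ :=
    rows ρ hρ F hF n K hnK ε₀ ε₁ hε₁ hε₀ hε₀a hreg V hV U hU hmin x
  exact sitePackage_of_rows x ρ S M hM1 U u A Hs C hA hchart h165 h157 hnear hfar he₁ he₃

end Top

end Summit.QuantumFields.YangMills.Theorems.HalvingSitePackage

end
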